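import Summits.BirchSwinnertonDyer.BirchSwinnertonDyer.Theorems.ByReductionTypeAtTwoOrdEisensteinHalfLowerBounds
import HarnessLib

/-!
# The crux `OrdEisensteinHalfAtTwo` IS Greenberg–Vatsal's pair of inequalities at `2` — class-level EQUIVALENCE
# (route ByReductionTypeAtTwo / TwoAdicConverse, item stmt-BirchSwinnertonDyer-19151; seat bsd-2adic-ord-3;
# sequel of `Theorems/ByReductionTypeAtTwoOrdEisensteinHalfLowerBounds.lean`)

WHAT. The sibling file proved, at a cyclotomic Kato datum with an INTEGRAL Néron normalisation
`ι L₀ = ϖ·L₂(f,α)`, that the Eisenstein half is `λ(L₀) ≤ λ(X) ∧ μ(L₀) ≤ μ(X)`. Here the Néron-integrality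
hypothesis is removed: for ANY rational `ϖ` an integral multiple `ι L₀ = 2ʲ·ϖ·L₂(f,α)` exists
(`exists_integral_slack`: `L₂(f,α) ∈ ι(Λ)` unconditionally at `2`, tree theorem
`X5.O1.exists_integral_mul_padicLFunction_two_of_padicValRat_nonneg`; `L₀ ≠ 0` by Rohrlich), and then the
Eisenstein half at the datum is `λ(L₀) ≤ λ(X) ∧ μ(L₀) ≤ μ(X) + j`
(`eisensteinAtDatum_iff_lam_le_and_mu_le_slack`: §1 of the sibling applied to `g = 2ʲ·f_X`, cancelling `2ʲ`
in the domain `ℚ₂⟦T⟧`). CONSEQUENCE (`ordEisensteinHalfAtTwo_iff_forall_lam_le_and_mu_le`): granted only the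
PUBLISHED input Kato 17.4 (1)(2) AT `2` for every curve (the third conjunct of the support item
`OrdPublishedInputsAtTwo`), the crux constant `Theorems.OrdHalvesAtTwo.OrdEisensteinHalfAtTwo` (= the route
decls `Theses.ByReductionTypeAtTwo.OrdEisensteinHalfAtTwo` / `Theses.TwoAdicConverse.OrdEisensteinHalfAtTwo`) is
EQUIVALENT to: for every non-CM `E/ℚ` good ordinary at `2`, every cyclotomic datum and every integral multiple
`ι L₀ = 2ʲ·ϖ·L₂(f,α)`, `λ(L₀) ≤ λ(X(E/ℚ_∞))` and `μ(L₀) ≤ μ(X(E/ℚ_∞)) + j` — Greenberg–Vatsal's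
«`λ_an ≤ λ_alg`, `μ_an ≤ μ_alg`» at `p = 2` (the reverse inequalities up to the slack are Kato's theorem). So
the item is EXACTLY the exhibit-type half of the `2`-adic main conjecture; nothing is asserted, nothing booked,
O1 stays OPEN.

References: K. Kato, Astérisque 295 (2004), Thm. 17.4 (1)(2) (p. 273); R. Greenberg, V. Vatsal, Invent. Math.
142 (2000), p. 4; D. Rohrlich, Invent. Math. 75 (1984), Theorem p. 409; C. Skinner, E. Urban, Invent. Math.
195 (2014), Conj. 3.6.8 (p odd).
-/

set_option autoImplicit false

noncomputable section

open scoped Classical MatrixGroups ModularForm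

open CongruenceSubgroup WeierstrassCurve Literature.NumberTheory.EllipticCurves
  Literature.NumberTheory.EllipticCurves.ModularForms Literature.NumberTheory.EllipticCurves.Rank1Residual
  Literature.NumberTheory.EllipticCurves.Rank1Residual.Typed
  Summit.BirchSwinnertonDyer.Rank1Residual.X1.MuLambda
  Summit.BirchSwinnertonDyer.Rank1Residual.X1.MuPart
  Summit.BirchSwinnertonDyer.Rank1Residual.X1.ParitySqueeze

namespace Summit.BirchSwinnertonDyer.BirchSwinnertonDyer.Theorems.EisensteinLowerBounds

section Slack

open Summit.BirchSwinnertonDyer.Rank1Residual Summit.BirchSwinnertonDyer.Rank1Residual.X5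

variable (W : WeierstrassCurve ℚ) [W.IsElliptic] [W.IsGloballyMinimal]

/-- **The Eisenstein half at a cyclotomic datum, slack form.** `E = W` good ordinary at `2`, Kato 17.4
(1)(2) AT `2` (`h17`), `f` a newform of `E`, `D` a dual datum with `char_Λ X = (f_X)`, `ϖ ∈ ℚ`, and
`L₀ ∈ Λ` nonzero with `ι L₀ = 2ʲ·ϖ·L₂(f,α)` (such `L₀` exists for every `j ≥ −ord₂ ϖ`). Then
(`∃ h ∈ Λ, ι f_X = ι h · ϖ·L₂(f,α)`) `↔ λ(L₀) ≤ λ(X) ∧ μ(L₀) ≤ μ(X) + j` — §1 applied to `g = 2ʲ·f_X`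
(`λ(2ʲ f_X) = λ(X)`, `μ(2ʲ f_X) = j + μ(X)`), cancelling `2ʲ` in the domain `ℚ₂⟦T⟧`.
[cite: Kato2004Asterisque, Thm. 17.4 (1)(2) (p. 273)] [cite: GreenbergVatsal2000, p. 4 (after Thm. (1.2))] -/
theorem eisensteinAtDatum_iff_lam_le_and_mu_le_slack {N : ℕ} [NeZero N] {f : CuspForm (Gamma0 N) 2}
    (h17 : kato_divisibility_allPrimes W 2 (f := f))
    {κ : ZpExtension ℚ 2} {γ : Field.absoluteGaloisGroup ℚ}
    (hκ : κ.IsCyclotomic) (hγ : κ.IsTopGenerator γ) (hγ' : IsCyclotomicVariable 2 γ)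
    (hord : IsOrdinaryAt W 2) (hf : IsNewformOf W f) (D : W.SelmerDualData κ γ)
    {fX : IwasawaAlgebra 2} (hchar : D.charIdeal = Ideal.span {fX})
    {ϖ : ℚ} {j : ℕ} {L₀ : IwasawaAlgebra 2} (hL₀0 : L₀ ≠ 0)
    (hL₀ : iwasawaToPowerSeries 2 L₀ =
      PowerSeries.C (((2 : ℚ) ^ j * ϖ : ℚ) : ℚ_[2]) * padicLFunction f (unitRoot W 2 : ℚ_[2])) :
    (∃ h : IwasawaAlgebra 2, iwasawaToPowerSeries 2 fX =
        iwasawaToPowerSeries 2 h * (PowerSeries.C (ϖ : ℚ_[2]) * padicLFunction f (unitRoot W 2 : ℚ_[2])))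
      ↔ lam L₀ ≤ D.lambda ∧ mu L₀ ≤ D.mu + j := by
  haveI : Module.Finite (IwasawaAlgebra 2) D.X := D.module_finite_holds hγ
  have hD : D.IsTorsion := (h17 κ γ hκ hγ hγ' hord hf D).1
  have hfX0 : fX ≠ 0 := by
    intro h0
    refine Module.charIdeal_ne_bot (IwasawaAlgebra 2) D.X ?_
    change D.charIdeal = ⊥
    rw [hchar, h0]
    exact Ideal.span_singleton_eq_bot.mpr rfl
  have hlamfX : lam fX = D.lambda := lam_generator_eq_lambdaInvariant D.X hD hfX0 hchar
  have hmufX : mu fX = D.mu := mu_generator_eq_muInvariant D.X hD hfX0 hchar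
  -- `g = 2ʲ · f_X`
  set g : IwasawaAlgebra 2 := PowerSeries.C (((2 : ℕ) : ℤ_[2]) ^ j) * fX with hg_def
  have hg0 : g ≠ 0 := mul_ne_zero (C_pow_ne_zero j) hfX0
  have hlamg : lam g = D.lambda := by rw [hg_def, lam_C_pow_mul j hfX0, hlamfX]
  have hmug : mu g = j + D.mu := by rw [hg_def, O1.mu_C_pow_mul hfX0 j, hmufX]
  -- `ι` of the constant `2ʲ`
  have hιC : iwasawaToPowerSeries 2 (PowerSeries.C (((2 : ℕ) : ℤ_[2]) ^ j)) =
      PowerSeries.C ((2 : ℚ_[2]) ^ j) := by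
    rw [iwasawaToPowerSeries, PowerSeries.map_C]
    push_cast
    rfl
  have hC2j : (PowerSeries.C ((2 : ℚ_[2]) ^ j) : PowerSeries ℚ_[2]) ≠ 0 := by
    rw [Ne, ← map_zero (PowerSeries.C (R := ℚ_[2])), PowerSeries.C_injective.eq_iff]
    exact pow_ne_zero j two_ne_zero
  have hL₀' : iwasawaToPowerSeries 2 L₀ = PowerSeries.C ((2 : ℚ_[2]) ^ j) *
      (PowerSeries.C (ϖ : ℚ_[2]) * padicLFunction f (unitRoot W 2 : ℚ_[2])) := by
    rw [hL₀, ← mul_assoc, ← map_mul]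
    push_cast
    ring_nf
  constructor
  · rintro ⟨h, hh⟩
    -- `ι g = ι (h L₀)`
    have he : g = h * L₀ := iwasawaToPowerSeries_injective 2 (by
      rw [hg_def, map_mul, hιC, hh, map_mul, hL₀']; ring)
    have := lam_le_and_mu_le_of_eq_mul hg0 he
    rw [hlamg, hmug] at this
    exact ⟨this.1, by omega⟩
  · rintro ⟨hlam, hmu⟩
    -- Kato pulled back to `Λ` at the normalisation `2ʲ ϖ`, then multiplied by `2ʲ`
    obtain ⟨-, a, n, hkey⟩ :=
      O1.MuZeroUpgrade.exists_mul_charGen_eq_of_kato_allPrimes W 2 h17 hκ hγ hγ' hord hf D hchar hL₀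
    have hkey' : (PowerSeries.C ((((2 : ℚ) ^ j * ϖ : ℚ)).num : ℤ_[2]) * a) * g =
        (PowerSeries.C (((2 : ℕ) : ℤ_[2]) ^ j) * (PowerSeries.C (((2 : ℕ) : ℤ_[2]) ^ n) *
          PowerSeries.C ((((2 : ℚ) ^ j * ϖ : ℚ)).den : ℤ_[2]))) * L₀ := by
      rw [hg_def]
      calc PowerSeries.C ((((2 : ℚ) ^ j * ϖ : ℚ)).num : ℤ_[2]) * a *
            (PowerSeries.C (((2 : ℕ) : ℤ_[2]) ^ j) * fX)
          = PowerSeries.C (((2 : ℕ) : ℤ_[2]) ^ j) *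
              ((PowerSeries.C ((((2 : ℚ) ^ j * ϖ : ℚ)).num : ℤ_[2]) * a) * fX) := by ring
        _ = PowerSeries.C (((2 : ℕ) : ℤ_[2]) ^ j) * (PowerSeries.C (((2 : ℕ) : ℤ_[2]) ^ n) *
              (PowerSeries.C ((((2 : ℚ) ^ j * ϖ : ℚ)).den : ℤ_[2]) * L₀)) := by rw [hkey]
        _ = _ := by ring
    have hB0 : (PowerSeries.C (((2 : ℕ) : ℤ_[2]) ^ j) * (PowerSeries.C (((2 : ℕ) : ℤ_[2]) ^ n) *
        PowerSeries.C ((((2 : ℚ) ^ j * ϖ : ℚ)).den : ℤ_[2])) : IwasawaAlgebra 2) ≠ 0 :=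
      mul_ne_zero (C_pow_ne_zero j) (C_pow_mul_C_natCast_ne_zero n (Rat.den_nz _))
    have hlamB : lam (PowerSeries.C (((2 : ℕ) : ℤ_[2]) ^ j) * (PowerSeries.C (((2 : ℕ) : ℤ_[2]) ^ n) *
        PowerSeries.C ((((2 : ℚ) ^ j * ϖ : ℚ)).den : ℤ_[2])) : IwasawaAlgebra 2) = 0 := by
      rw [lam_C_pow_mul j (C_pow_mul_C_natCast_ne_zero n (Rat.den_nz _)),
        lam_C_pow_mul_C_natCast n (Rat.den_nz _)]
    obtain ⟨u, hu⟩ := exists_unit_eq_C_pow_mul_mul hg0 hL₀0 hB0 hlamB hkey'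
      (by rw [hlamg]; exact hlam) (by rw [hmug]; omega)
    refine ⟨PowerSeries.C (((2 : ℕ) : ℤ_[2]) ^ (mu g - mu L₀)) * u, ?_⟩
    -- cancel `2ʲ` in `ℚ₂⟦T⟧`
    apply mul_left_cancel₀ hC2j
    calc PowerSeries.C ((2 : ℚ_[2]) ^ j) * iwasawaToPowerSeries 2 fX
        = iwasawaToPowerSeries 2 g := by rw [hg_def, map_mul, hιC]
      _ = iwasawaToPowerSeries 2 (PowerSeries.C (((2 : ℕ) : ℤ_[2]) ^ (mu g - mu L₀)) * u) *
            iwasawaToPowerSeries 2 L₀ := by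
          rw [← map_mul]; exact congrArg (iwasawaToPowerSeries 2) hu
      _ = _ := by rw [hL₀']; ring

/-- An integral normalisation with slack `j` always exists: for `j` with `0 ≤ j + ord₂ ϖ`, there is
`L₀ ∈ Λ` with `ι L₀ = 2ʲ·ϖ·L₂(f,α)` (`L₂(f,α) ∈ ι(Λ)` unconditionally at `2`, tree theorem
`X5.O1.exists_integral_mul_padicLFunction_two_of_padicValRat_nonneg`), and `L₀ ≠ 0` by Rohrlich
(`padicLFunction_unitRoot_ne_zero`). [cite: MazurTateTeitelbaum1986Invent, §I.12]
[cite: RohrlichInventiones1984, Theorem (p. 409)] -/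
theorem exists_integral_slack {N : ℕ} [NeZero N] {f : CuspForm (Gamma0 N) 2} (hord : IsOrdinaryAt W 2)
    (hf : IsNewformOf W f) {ϖ : ℚ} (hϖ0 : ϖ ≠ 0) :
    ∃ (j : ℕ) (L₀ : IwasawaAlgebra 2), L₀ ≠ 0 ∧ iwasawaToPowerSeries 2 L₀ =
      PowerSeries.C (((2 : ℚ) ^ j * ϖ : ℚ) : ℚ_[2]) * padicLFunction f (unitRoot W 2 : ℚ_[2]) := by
  set j : ℕ := (-(padicValRat 2 ϖ)).toNat with hj
  have hϖ' : (2 : ℚ) ^ j * ϖ ≠ 0 := mul_ne_zero (pow_ne_zero j two_ne_zero) hϖ0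
  have hval : 0 ≤ padicValRat 2 ((2 : ℚ) ^ j * ϖ) := by
    have h2 : padicValRat 2 (2 : ℚ) = 1 := by exact_mod_cast padicValRat.self (p := 2) one_lt_two
    rw [padicValRat.mul (pow_ne_zero j two_ne_zero) hϖ0, padicValRat.pow, h2, mul_one]
    have : (-(padicValRat 2 ϖ)) ≤ (j : ℤ) := by rw [hj]; exact Int.self_le_toNat _
    linarith
  obtain ⟨L₀, hL₀⟩ := O1.exists_integral_mul_padicLFunction_two_of_padicValRat_nonneg W hord hf hval
  refine ⟨j, L₀, ?_, hL₀⟩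
  intro h0
  rw [h0, map_zero] at hL₀
  have hC : (PowerSeries.C (((2 : ℚ) ^ j * ϖ : ℚ) : ℚ_[2]) : PowerSeries ℚ_[2]) ≠ 0 := by
    rw [Ne, ← map_zero (PowerSeries.C (R := ℚ_[2])), PowerSeries.C_injective.eq_iff]
    exact_mod_cast hϖ'
  exact mul_ne_zero hC (padicLFunction_unitRoot_ne_zero hord hf) hL₀.symm

end Slack

/-- **THE CRUX AS AN INVARIANT INEQUALITY (class-level equivalence).** Granted the PUBLISHED input Kato
17.4 (1)(2) AT `2` for every curve (`h17`, the third conjunct of the support item `OrdPublishedInputsAtTwo`),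
the crux constant `Theorems.OrdHalvesAtTwo.OrdEisensteinHalfAtTwo` (= the route decls
`Theses.ByReductionTypeAtTwo.OrdEisensteinHalfAtTwo` / `Theses.TwoAdicConverse.OrdEisensteinHalfAtTwo`) holds
IF AND ONLY IF for every non-CM `E/ℚ` good ordinary at `2`, every cyclotomic datum `D`, the newform
`f`, the Néron ratio `ϖ` (`ϖ·Ω_E = Ω⁺_f`) and every integral multiple `ι L₀ = 2ʲ·ϖ·L₂(f,α)`
(`L₀ ≠ 0`): `λ(L₀) ≤ λ(X(E/ℚ_∞))` and `μ(L₀) ≤ μ(X(E/ℚ_∞)) + j` — Greenberg–Vatsal's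
«`λ_an ≤ λ_alg`, `μ_an ≤ μ_alg`» at `p = 2` (the reverse inequalities up to the slack are Kato's theorem).
This is the item's honest residue: the EXHIBIT-type half of the `2`-adic main conjecture.
[cite: GreenbergVatsal2000, p. 4 (after Thm. (1.2))] [cite: Kato2004Asterisque, Thm. 17.4 (1)(2) (p. 273)]
[cite: SkinnerUrban2014, Conj. 3.6.8 (p. 45) (shape; p odd in print)] -/
theorem ordEisensteinHalfAtTwo_iff_forall_lam_le_and_mu_le
    (h17 : ∀ (W : WeierstrassCurve ℚ) [W.IsElliptic] [W.IsGloballyMinimal]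
      [NeZero (W.conductorNorm ℤ)] (f : CuspForm (Gamma0 (W.conductorNorm ℤ)) 2),
      kato_divisibility_allPrimes W 2 (f := f)) :
    Summit.BirchSwinnertonDyer.BirchSwinnertonDyer.Theorems.OrdHalvesAtTwo.OrdEisensteinHalfAtTwo ↔
    ∀ (W : WeierstrassCurve ℚ) [W.IsElliptic] [W.IsGloballyMinimal], ¬ W.HasCM →
      Literature.NumberTheory.EllipticCurves.Rank1Residual.GoodOrd W 2 →
      ∀ (κ : ZpExtension ℚ 2) (γ : Field.absoluteGaloisGroup ℚ), κ.IsCyclotomic → κ.IsTopGenerator γ →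
        IsCyclotomicVariable 2 γ →
      ∀ [NeZero (W.conductorNorm ℤ)] (f : CuspForm (Gamma0 (W.conductorNorm ℤ)) 2), IsNewformOf W f →
      ∀ (ϖ : ℚ), (ϖ : ℝ) * W.realPeriodRat = plusPeriod f →
      ∀ (D : W.SelmerDualData κ γ) (j : ℕ) (L₀ : IwasawaAlgebra 2), L₀ ≠ 0 →
        iwasawaToPowerSeries 2 L₀ =
          PowerSeries.C (((2 : ℚ) ^ j * ϖ : ℚ) : ℚ_[2]) * padicLFunction f (unitRoot W 2 : ℚ_[2]) →
        lam L₀ ≤ D.lambda ∧ mu L₀ ≤ D.mu + j := by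
  constructor
  · intro hE W _ _ hcm hgo κ γ hκ hγ hγ' _ f hf ϖ hϖ D j L₀ hL₀0 hL₀
    have hord : IsOrdinaryAt W 2 := hgo
    haveI : (Module.charIdeal (IwasawaAlgebra 2) D.X).IsPrincipal := charIdeal_isPrincipal_holds 2 D.X
    obtain ⟨fX, hfX⟩ := Submodule.IsPrincipal.principal (Module.charIdeal (IwasawaAlgebra 2) D.X)
    have hchar : D.charIdeal = Ideal.span {fX} := hfX
    exact (eisensteinAtDatum_iff_lam_le_and_mu_le_slack W (h17 W f) hκ hγ hγ' hord hf D hchar hL₀0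
      hL₀).mp (hE W hcm hgo κ γ hκ hγ hγ' hord f hf ϖ hϖ D fX hchar)
  · intro hB W _ _ hcm hgo κ γ hκ hγ hγ' hord _ f hf ϖ hϖ D fX hchar
    have hϖ0 : ϖ ≠ 0 := by
      rintro rfl
      have hper : 0 < plusPeriod f := IsNewform0.plusPeriod_pos_holds hf.1 hf.coeffField_eq_bot
      rw [← hϖ, Rat.cast_zero, zero_mul] at hper
      exact lt_irrefl _ hper
    obtain ⟨j, L₀, hL₀0, hL₀⟩ := exists_integral_slack W hord hf hϖ0
    exact (eisensteinAtDatum_iff_lam_le_and_mu_le_slack W (h17 W f) hκ hγ hγ' hord hf D hchar hL₀0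
      hL₀).mpr (hB W hcm hgo κ γ hκ hγ hγ' f hf ϖ hϖ D j L₀ hL₀0 hL₀)

end Summit.BirchSwinnertonDyer.BirchSwinnertonDyer.Theorems.EisensteinLowerBounds

end
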